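import Summits.BirchSwinnertonDyer.BirchSwinnertonDyer.Theorems.GenusKolyvaginAtTwoPowDvdShaCardAtTwoRTLocalKernelExact
import Summits.BirchSwinnertonDyer.BirchSwinnertonDyer.Theorems.GenusKolyvaginAtTwoPowDvdShaCardAtTwoRTLocalKernelTwoTorsion
import Summits.BirchSwinnertonDyer.BirchSwinnertonDyer.Theorems.GenusKolyvaginAtTwoEquivariantKolyvaginExactAtTwoLocalDualityOrder
import Literature.NumberTheory.EllipticCurves.DiscreteH1Equiv
import HarnessLib

/-!
# Route `GenusKolyvaginAtTwo`, LINE 18 / LINE 19 (L_T stmt-BirchSwinnertonDyer-23242, L⁺_T stmt-23379) — THE LOCAL KERNEL AT A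
# RAMIFIED GOOD ODD PLACE IS SATURATED: `W_{v,K} = H¹(ℚ_v, E)[2]`; every `2`-torsion class of `H¹(ℚ, E)` dies at `K_w`

Seat `bsd-line-gk2-p3` g20 (cell `bsd-f1-sign2`), `--supports stmt-BirchSwinnertonDyer-23242` (helper; closes nothing).
THEOREMS ONLY (no definition, no named fact, no `sorry`); BSD is not proved by any of this.  Sequel (3/3) of
`…RTLocalKernelLowerBound` / `…RTLocalKernelExact` (Kramer 1981 Prop. 3 in full: `#W_{v,K} = #E(ℚ_v)[2]`).

WHAT.  With Tate's local duality count `#H¹(ℚ_v, E)[2] = #E(ℚ_v)[2]` (tree: `LocalDualityOrder.natCard_torsionBy_localH1_eq_of_not_mem`,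
unconditional off the residue characteristic, transported from `localH1` to `galH1` of the base change along
`localPointsEquivGeomPoints`) and the g17 fact that `W_{v,K}` is killed by `2` (`two_nsmul_eq_zero_of_mem_localKernel`):
* **`localKernel_eq_torsionBy_two`**: `W_{v,K} = H¹(ℚ_v, E)[2]` as subgroups — at a place `w ∣ v` of `K ∋ √d`, `v(d) = 1`,
  `[K_w : ℚ_v] = 2`, `v ∤ 2` good for `E/ℚ`;
* **`mem_localRestrictionKer_of_two_nsmul_eq_zero`**: every `c ∈ H¹(ℚ, E)` with `2c = 0` dies in `H¹(K_w, E)`.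
So at level `2` the `d_K`-relaxed local condition «restriction to `K` is locally trivial at `w`» of LINE 18/19 is NO CONDITION at the
primes of `d_K`: `res⁻¹Ш(E_K)[2]` is `Ш(E/ℚ)` relaxed completely there (memo `Lines/plus-descent-stubJ-audit.md` §2(a), the local
half of «the relaxed groups are as large as Greenberg–Wiles allows», which kills stub J).

References: [Kramer1981] §2 Prop. 3, §4 (11)–(13); [MilneADT2006] I Thm. 3.2, Lemma 3.3, Cor. 3.4; [Matsuno2009] §3.
-/

set_option autoImplicit false
-- the Theorems namespace of this sub repeats the summit name by design (D-0017 nested layout)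
set_option linter.dupNamespace false

noncomputable section

open scoped Classical

namespace Summit.BirchSwinnertonDyer.BirchSwinnertonDyer.Theorems.GenusExact.PlusDescent

open WeierstrassCurve Literature.NumberTheory.EllipticCurves Literature.NumberTheory.GaloisRepresentations
  Literature.Barriers.BirchSwinnertonDyer

universe u

/-! ## §4 The local kernel is SATURATED: `W_{v,K} = H¹(ℚ_v, E)[2]`, so every `2`-torsion class dies at `K_w` -/

section Saturated

open NumberField IsDedekindDomain Literature.NumberTheory.GaloisRepresentations.IsNonarchimedeanLocalField

/-- **`W_{v,K} = H¹(ℚ_v, E)[2]` at a ramified good odd place**: Matsuno's local kernel is the WHOLE `2`-torsion of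
`H¹(ℚ_v, E)` (it is contained in it and killed by `2` by the seat's g17 `two_nsmul_eq_zero_of_mem_localKernel`; both have
`#E(ℚ_v)[2]` elements: `natCard_localKernel_eq_natCard_twoTorsion` and Tate's local duality count
`LocalDualityOrder.natCard_torsionBy_localH1_eq_of_not_mem` transported along `localPointsEquivGeomPoints`).  So at level `2`
the `d_K`-relaxed local condition «dies over `K_w`» is NO condition. [cite: Kramer1981, §2 Prop. 3] [cite: MilneADT2006, I Thm. 3.2] -/
theorem localKernel_eq_torsionBy_two (E : WeierstrassCurve ℚ) [E.IsElliptic]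
    (K : Type) [Field K] [NumberField K] (v : HeightOneSpectrum (𝓞 ℚ)) (w : HeightOneSpectrum (𝓞 K))
    [w.asIdeal.LiesOver v.asIdeal]
    (h2 : letI : Algebra (v.adicCompletion ℚ) (w.adicCompletion K) :=
        (Literature.NumberTheory.EllipticCurves.adicCompletionMap (K := ℚ) K v w).toAlgebra
      Module.finrank (v.adicCompletion ℚ) (w.adicCompletion K) = 2)
    (hw : ((2 : ℕ) : 𝓞 K) ∉ w.asIdeal) (hv2 : ((2 : ℕ) : 𝓞 ℚ) ∉ v.asIdeal) (hgood : E.HasGoodReductionAt v)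
    {d : ℚ} (hdv : v.valuation ℚ d = WithZero.exp (-1 : ℤ)) (θ : K) (hθ : θ ^ 2 = algebraMap ℚ K d) :
    Matsuno2009.localKernel E K v w =
      AddSubgroup.torsionBy ((E.baseChange (v.adicCompletion ℚ)).galH1) ((2 : ℕ) : ℤ) := by
  letI instQv : Algebra ℚ (v.adicCompletion ℚ) :=
    IsDedekindDomain.HeightOneSpectrum.instAlgebraAdicCompletion (𝓞 ℚ) ℚ v
  set F := v.adicCompletion ℚ with hFdef
  -- `⊆`: the kernel is killed by `2`
  have hle : Matsuno2009.localKernel E K v w ≤ AddSubgroup.torsionBy ((E.baseChange F).galH1) ((2 : ℕ) : ℤ) :=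
    fun c hc ↦ AddSubgroup.torsionBy.nsmul_iff.mpr (two_nsmul_eq_zero_of_mem_localKernel E K v w h2 hc)
  -- the count of `H¹(ℚ_v, E)[2]`, transported from `localH1` to `galH1` of the base change
  let eH : E.localH1 F ≃+ (E.baseChange F).galH1 :=
    h1Equiv (localPointsEquivGeomPoints E F) (localPointsEquivGeomPoints_smul E F)
  let eT : AddSubgroup.torsionBy (E.localH1 F) ((2 : ℕ) : ℤ) ≃
      AddSubgroup.torsionBy ((E.baseChange F).galH1) ((2 : ℕ) : ℤ) :=
    eH.toEquiv.subtypeEquiv fun x ↦ by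
      change x ∈ AddSubgroup.torsionBy _ _ ↔ eH x ∈ AddSubgroup.torsionBy _ _
      rw [AddSubgroup.torsionBy.nsmul_iff, AddSubgroup.torsionBy.nsmul_iff, ← map_nsmul,
        map_eq_zero_iff eH eH.injective]
  have hcountH : Nat.card (AddSubgroup.torsionBy ((E.baseChange F).galH1) ((2 : ℕ) : ℤ)) =
      Nat.card {P : (E.baseChange F).toAffine.Point // 2 • P = 0} := by
    rw [← Nat.card_congr eT]
    have h := LocalDualityOrder.natCard_torsionBy_localH1_eq_of_not_mem (K := ℚ) v E (p := 2) (k := 1)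
      one_ne_zero hv2
    rw [pow_one] at h
    change Nat.card (AddSubgroup.torsionBy (E.localH1 F) ((2 : ℕ) : ℤ)) = _ at h
    rw [h]
    exact Nat.card_congr (Equiv.subtypeEquivRight fun P ↦ by rw [AddMonoidHom.mem_ker, nsmulAddMonoidHom_apply])
  -- both sides have `#E(ℚ_v)[2]` elements
  haveI : Finite {P : (E.baseChange F).toAffine.Point // 2 • P = 0} := by
    haveI := E.finite_ker_nsmul_adicCompletion v (n := 2) two_ne_zero
    exact Finite.of_equiv (nsmulAddMonoidHom 2 : (E.baseChange F).toAffine.Point →+ _).ker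
      (Equiv.subtypeEquivRight fun P ↦ by rw [AddMonoidHom.mem_ker, nsmulAddMonoidHom_apply])
  have hpos : 0 < Nat.card {P : (E.baseChange F).toAffine.Point // 2 • P = 0} :=
    Nat.card_pos_iff.mpr ⟨⟨⟨0, by rw [nsmul_zero]⟩⟩, inferInstance⟩
  haveI : Finite (AddSubgroup.torsionBy ((E.baseChange F).galH1) ((2 : ℕ) : ℤ)) :=
    Nat.finite_of_card_ne_zero (by rw [hcountH]; exact hpos.ne')
  refine AddSubgroup.eq_of_le_of_card_ge hle ?_
  rw [hcountH, ← natCard_localKernel_eq_natCard_twoTorsion E K v w h2 hw hv2 hgood hdv θ hθ]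

/-- **Every `2`-torsion class of `H¹(ℚ, E)` dies at `K_w`** for `w ∣ v` ramified good odd as above: the `d_K`-relaxed condition
of LINE 18/19 at such a place is vacuous on `H¹(ℚ, E)[2]`, i.e. `res⁻¹Ш(E_K)[2]` is `Ш` RELAXED COMPLETELY at the primes of
`d_K` (Kramer's genus theory for elements of order 2; memo `Lines/plus-descent-stubJ-audit.md` §2(a)).
[cite: Kramer1981, §2 Prop. 3 and §4 (13)] -/
theorem mem_localRestrictionKer_of_two_nsmul_eq_zero (E : WeierstrassCurve ℚ) [E.IsElliptic]
    (K : Type) [Field K] [NumberField K] (v : HeightOneSpectrum (𝓞 ℚ)) (w : HeightOneSpectrum (𝓞 K))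
    [w.asIdeal.LiesOver v.asIdeal]
    (h2 : letI : Algebra (v.adicCompletion ℚ) (w.adicCompletion K) :=
        (Literature.NumberTheory.EllipticCurves.adicCompletionMap (K := ℚ) K v w).toAlgebra
      Module.finrank (v.adicCompletion ℚ) (w.adicCompletion K) = 2)
    (hw : ((2 : ℕ) : 𝓞 K) ∉ w.asIdeal) (hv2 : ((2 : ℕ) : 𝓞 ℚ) ∉ v.asIdeal) (hgood : E.HasGoodReductionAt v)
    {d : ℚ} (hdv : v.valuation ℚ d = WithZero.exp (-1 : ℤ)) (θ : K) (hθ : θ ^ 2 = algebraMap ℚ K d)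
    {c : E.galH1} (hc : 2 • c = 0) : c ∈ E.localRestrictionKer (w.adicCompletion K) := by
  letI instQv : Algebra ℚ (v.adicCompletion ℚ) :=
    IsDedekindDomain.HeightOneSpectrum.instAlgebraAdicCompletion (𝓞 ℚ) ℚ v
  letI : Algebra (v.adicCompletion ℚ) (w.adicCompletion K) :=
    (Literature.NumberTheory.EllipticCurves.adicCompletionMap (K := ℚ) K v w).toAlgebra
  haveI : IsScalarTower ℚ (v.adicCompletion ℚ) (w.adicCompletion K) := IsScalarTower.rat
  rw [mem_localRestrictionKer_iff_resBaseChange_mem E (L := v.adicCompletion ℚ) (E' := w.adicCompletion K)]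
  have hmem : resBaseChange E (v.adicCompletion ℚ) c ∈ Matsuno2009.localKernel E K v w := by
    rw [localKernel_eq_torsionBy_two E K v w h2 hw hv2 hgood hdv θ hθ, AddSubgroup.torsionBy.nsmul_iff, ← map_nsmul, hc,
      map_zero]
  unfold Matsuno2009.localKernel at hmem
  exact hmem

end Saturated

end Summit.BirchSwinnertonDyer.BirchSwinnertonDyer.Theorems.GenusExact.PlusDescent

end
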